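import Summits.BirchSwinnertonDyer.BirchSwinnertonDyer.Theorems.KolyvaginDepthDoorDepthTableRowsExactReadingZhang2
import Summits.BirchSwinnertonDyer.BirchSwinnertonDyer.Theorems.Rank2Observatory389a1TwoDescRankTwo
import HarnessLib

/-!
# Route `KolyvaginDepthDoor`, crux `KolyvaginDepthSupplyKN` (stmt-BirchSwinnertonDyer-22820) —
# DEPTH TABLE v11, THE JETCHEV–LAUTER–STEIN ROW: `389a1` at `(p, d_K) = (5, −7)` with the
# `rank E(ℚ) = 2` conjunct DISCHARGED by the tree's kernel 2-descent certificate

Helper file of the lead prover of line `levelone` (kdd-p1 g15; `--supports stmt-BirchSwinnertonDyer-22820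
--as helper`); it closes nothing and BSD is not proved by it.

The v10 row `C389a1.exactRowZhang_5_neg7` (g14, file `KolyvaginDepthDoorDepthTableRowsExactReadingZhang2`)
reads the `389a1` row EXACTLY, for ANY imaginary quadratic `K` with `d_K = −7` (Jetchev–Lauter–Stein's
field): «∃ frame, Kolyvagin prime `ℓ`, datum: `c_1(ℓ) ≠ 0`» `↔` «`rank E(ℚ) = 2` ∧ `Ш(E/ℚ)[5] = 0` ∧
`#Sel_5(E^{(−7)}/ℚ) ≤ 5`», the lower bound `2 ≤ rank` being the kernel certificate
`Curve389a1.two_le_mordellWeilRank` and the upper bound left inside the statement. The tree HOLDS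
`rank E(ℚ) = 2` for `389a1`: `Rank2Observatory.C389a1.mordellWeilRank_eq_two` (general 2-descent over
the totally real cubic field of discriminant `1556`, Cassels' `x − θ` map, norm-square-residue and
three-real-place sieves; kernel `decide` only; file `Rank2Observatory389a1TwoDescRankTwo`). Feeding it
in (`Curve389a1.E_eq_map` identifies the two models):

* `exactRowZhang_5_neg7_rankFree` — «∃ frame, Kolyvagin prime `ℓ`, datum of conductor `ℓ` with
  `c_1(ℓ) ≠ 0`» `↔` «`Ш(389a1/ℚ)[5] = 0` ∧ `#Sel_5(389a1^{(−7)}/ℚ) ≤ 5`».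

One computed bit at `p = 5` (the instrument row; Jetchev–Lauter–Stein computed the `p = 3` analogue,
Prop. 3.10) is EXACTLY «`Ш(389a1)[5] = 0` and `dim_𝔽₅ Sel_5` of the `−7`-twist (the rank-1 curve
`19061b`-class twist) is `≤ 1`». CONDITIONAL on (γ) = Gross 1991 Prop. 3.7 (2) and W. Zhang 2014 Lemma
8.4 (1) / Thm. 9.1 by name; per curve; BSD is NOT proved by it.

References: [WZhang2014] Lemma 8.4 (1) (p. 236), Thm. 9.1 (p. 240); [GrossLMS1991] Prop. 3.7 (2);
[JetchevLauterStein2009] §3.6, Prop. 3.10 (arXiv:0707.0032); [Cassels1991LecturesEllipticCurves] §15;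
[CremonaAlgorithms1997] Table 1 (389a1), §3.6.
-/

set_option linter.dupNamespace false

noncomputable section

open scoped Classical NumberField

namespace Summit.BirchSwinnertonDyer.BirchSwinnertonDyer.Theorems.KolyvaginDepthDoor

open Literature.NumberTheory.EllipticCurves Literature.NumberTheory.EllipticCurves.ModularForms
  WeierstrassCurve NumberField IsDedekindDomain
open Summit.BirchSwinnertonDyer.BirchSwinnertonDyer.Theorems
open Summit.BirchSwinnertonDyer.BirchSwinnertonDyer.Rank2Observatory

namespace C389a1

/-- **`rank_ℤ 389a1(ℚ) = 2` on the model `Curve389a1.E`** — the tree's kernel 2-descent certificate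
`Rank2Observatory.C389a1.mordellWeilRank_eq_two` (stated on the integral model read over `ℚ`) moved
along `Curve389a1.E_eq_map`. UNCONDITIONAL. [cite: CremonaAlgorithms1997, Table 1 (389a1), §3.6]
[cite: Cassels1991LecturesEllipticCurves, §15] -/
theorem mordellWeilRank_E_eq_two : Curve389a1.E.mordellWeilRank = 2 := by
  rw [Curve389a1.E_eq_map]
  exact Summit.BirchSwinnertonDyer.BirchSwinnertonDyer.Rank2Observatory.C389a1.mordellWeilRank_eq_two

/-- **DEPTH-TABLE ROW `389a1`, `(p, d_K) = (5, −7)`, v11 — RANK DISCHARGED.** For `E = 389a1` and ANY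
imaginary quadratic `K` with `d_K = −7`: «some frame, some Kolyvagin prime `ℓ`, some datum of
conductor `ℓ` with `c_1(ℓ) ≠ 0`» `↔` «`Ш(E/ℚ)[5] = 0` ∧ `#Sel_5(E^{(−7)}/ℚ) ≤ 5`». From the v10 row
`C389a1.exactRowZhang_5_neg7` and `mordellWeilRank_E_eq_two`. Every side condition is a kernel theorem;
CONDITIONAL on (γ) and W. Zhang's Lemma 8.4 (1) / Thm. 9.1 by name; per curve; BSD is not proved by it.
[cite: WZhang2014, Lemma 8.4 (1) (p. 236), Thm. 9.1 (p. 240)] [cite: GrossLMS1991, Prop. 3.7 (2)]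
[cite: JetchevLauterStein2009, §3.6, Prop. 3.10 (arXiv:0707.0032)] [cite: CremonaAlgorithms1997, Table 1 (389a1)] -/
theorem exactRowZhang_5_neg7_rankFree
    (h372 : GrossLMS1991.prop37_2_frobeniusCongruence)
    (h84 : Literature.NumberTheory.EllipticCurves.WZhang2014_lemma84_exists_minimal_kolyvaginClass_one_selmerCard)
    (K : Type) [Field K] [NumberField K] (hK : IsImaginaryQuadratic K)
    (hD : NumberField.discr K = -7) :
    haveI := curve389a1_isGloballyMinimal;
    haveI : NeZero (Curve389a1.E.conductorNorm ℤ) := neZero_conductorNorm_of_isElliptic _;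
    haveI := Fact.mk (by norm_num : Nat.Prime 5);
    (∃ (Dt : ModularParametrizationData Curve389a1.E (Curve389a1.E.conductorNorm ℤ)) (β : ℤ)
      (ι : K →+* ℂ) (ℓ : ℕ) (d : KolyvaginHeegnerData Dt β ι ℓ),
      ℓ.Prime ∧ Zhang2014.IsKolyvaginPrime (Curve389a1.E.conductorNorm ℤ) Curve389a1.E K 5 ℓ ∧
        d.kolyvaginClass (p := 5) (by norm_num) 1 ≠ 0) ↔
    ((Curve389a1.E.sha ⊓ AddSubgroup.torsionBy Curve389a1.E.galH1 ((5 : ℕ) : ℤ) : AddSubgroup _) = ⊥ ∧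
      Nat.card ((Curve389a1.E.quadraticTwist (NumberField.discr K : ℚ)).selmerGroup (5 : ℕ)) ≤ 5) := by
  haveI := curve389a1_isGloballyMinimal
  haveI : NeZero (Curve389a1.E.conductorNorm ℤ) := neZero_conductorNorm_of_isElliptic _
  haveI := Fact.mk (by norm_num : Nat.Prime 5)
  exact (exactRowZhang_5_neg7 h372 h84 K hK hD).trans (and_iff_right mordellWeilRank_E_eq_two)

end C389a1

end Summit.BirchSwinnertonDyer.BirchSwinnertonDyer.Theorems.KolyvaginDepthDoor

end
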